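import Mathlib.MeasureTheory.Integral.IntervalIntegral.FundThmCalculus
import Literature.Analysis.FunctionSpaces.TorusCalculusProofs
import Literature.Analysis.FunctionSpaces.TorusFluidGlueProofs
import Literature.Analysis.FluidPDE.WeakSolution
import HarnessLib

/-!
# Discharged fact: classical solutions on `T^d` are forced weak solutions with datum

`Literature.Analysis.FluidPDE.WeakSolution` records as the named fact
`Torus.IsClassicalNSSolutionOn.isWeakNSSolutionForcedOn` that a classical solution `(u, p)` of
the forced Navier–Stokes system on a time set `S ⊇ [0, T]` is a forced weak (pressure-free)
solution on `T^d × [0, T)` with datum `u 0` (`Torus.IsWeakNSSolutionForcedOn T ν f (u 0) u`: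
the weak identity
`∫₀ᵀ ∫ (⟪u, ∂ₜψ⟫ + ⟪u, (u·∇)ψ⟫ + ν⟪u, Δψ⟫ + ⟪f, ψ⟫) + ∫ ⟪u(0), ψ(0)⟫ = 0`
against divergence-free test fields `ψ` vanishing near `T` but possibly nonzero at `t = 0`;
Temam 1984, Ch. III §1.1, (1.22)–(1.23); Leray 1934, (17)). It is proved here
(`Torus.IsClassicalNSSolutionOn.isWeakNSSolutionForcedOn_holds`), by the argument printed in
Robinson–Rodrigo–Sadowski 2016, §3.1 (PDF pp. 58–59, "take a classical solution, multiply by a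
test function, integrate by parts in space, where on the torus there are no boundary terms, and
in time, where the boundary term at `t = 0` produces the datum"), exactly as the unforced,
datum-free twin `Torus.IsClassicalNSSolutionOn.isWeakNSSolutionOn_holds` of
`TorusFluidGlueProofs`: `u` is continuous on the compact `[0, T] × T^d`, hence measurable and
square integrable; `div u(t) = 0` classically implies weakly; and for a divergence-free test
field `ψ` the pairing `E(t) = ∫ ⟪u(t), ψ(t)⟫` has `E(T) = 0`, `E(0) = ∫ ⟪u(0), ψ(0)⟫`, is
differentiable within `[0, T]` with
`E' = ∫ (⟪u, ∂ₜψ⟫ + ⟪νΔu − ∇p − (u·∇)u + f, ψ⟫)` (differentiation under the integral,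
`Torus.IsSmoothSpaceTimeOn.hasDerivWithinAt_integral`, and the momentum equation), which the
integrations by parts `∫ ⟪Δu, ψ⟫ = ∫ ⟪u, Δψ⟫`, `∫ ⟪∇p, ψ⟫ = 0`, `∫ ⟪(u·∇)u, ψ⟫ = -∫ ⟪u, (u·∇)ψ⟫`
turn into the weak integrand; `∫₀ᵀ E' = E(T) − E(0) = −∫ ⟪u(0), ψ(0)⟫` is the identity.
The statement was found faithful as vendored (not mis-stated); no smoothness of `f` is needed
beyond what the momentum equation forces on `[0, T] × T^d`.

## Time restriction and domain restriction (whole space)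

The second part of the file (namespace `Literature.Fluid`) discharges the two restriction facts of
`WeakSolution` on a finite-dimensional inner product space `E`:

* `Fluid.IsWeakNSSolutionOn.mono_holds` (usable form `Fluid.IsWeakNSSolutionOn.of_le`) — a weak
  solution on `[0, T)` is one on `[0, T')` for `T' ≤ T` (Leray 1934, §III): a divergence-free
  test field supported in `(-∞, T') × E` is one supported in `(-∞, T) × E`, and it vanishes with
  `∂ₜ`, `D`, `Δ` at every `(t, x)` with `t ≥ T'`, so the weak integrands agree
  (`setIntegral_eq_of_subset_of_forall_sdiff_eq_zero`);
* `Fluid.IsDistributionalNSSolutionOn.mono_holds` (usable form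
  `Fluid.IsDistributionalNSSolutionOn.of_le`) — a distributional solution on an open region `Q`
  is one on every open `Q' ≤ Q` (Caffarelli–Kohn–Nirenberg 1982, §2), by the same vanishing of
  test fields on `Q'` at the points of `Q \ Q'`;

with the pointwise vanishing lemmas `Fluid.IsSpaceTimeTestOn.deriv_eq_zero`,
`timeDeriv_eq_zero`, `fderiv_slice_eq_zero`, `laplacian_slice_eq_zero`, `slice_eq_zero`.

## References

* R. Temam, *Navier–Stokes Equations. Theory and Numerical Analysis*, 3rd ed. (1984), Ch. III
  §1.1, (1.22)–(1.23) (weak formulation with initial datum); Ch. II §1.2, Lemma 1.3.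
* J. C. Robinson, J. L. Rodrigo, W. Sadowski, *The Three-Dimensional Navier–Stokes Equations*,
  CUP 2016, §3.1, Def. 3.3 (from classical to weak solutions). [RobinsonRodrigoSadowski2016]
* J. Leray, *Sur le mouvement d'un liquide visqueux emplissant l'espace*, Acta Math. 63 (1934),
  (17), §III.
* L. Caffarelli, R. Kohn, L. Nirenberg, *Partial regularity of suitable weak solutions of the
  Navier–Stokes equations*, CPAM 35 (1982), §2.
-/

open MeasureTheory Set Topology Filter
open scoped InnerProductSpace ContDiff ENNReal

noncomputable section

namespace Literature.Analysis.FluidPDE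

namespace Torus

variable {d : Type*} [Fintype d] [DecidableEq d]

/-- Discharge of the named fact `Torus.IsClassicalNSSolutionOn.isWeakNSSolutionForcedOn`
(`WeakSolution`): a classical solution of the forced Navier–Stokes system on a time set
`S ⊇ [0, T]` is a forced weak solution on `T^d × [0, T)` with datum `u 0` (Temam 1984, Ch. III
§1.1, (1.22)–(1.23); Robinson–Rodrigo–Sadowski 2016, §3.1: multiply the momentum equation by a
divergence-free test field, integrate by parts on `T^d` — no boundary terms — and in time, the
boundary term at `t = 0` being the datum pairing `∫ ⟪u(0), ψ(0)⟫`). [cite: Temam1984, Ch. III §1.1 (1.22)–(1.23)] -/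
theorem _root_.Literature.Analysis.FunctionSpaces.Torus.IsClassicalNSSolutionOn.isWeakNSSolutionForcedOn_holds {T ν : ℝ}
    {f u : ℝ → UnitAddTorus d → EuclideanSpace ℝ d} {p : ℝ → UnitAddTorus d → ℝ} :
    FunctionSpaces.Torus.IsClassicalNSSolutionOn.isWeakNSSolutionForcedOn (d := d) (T := T) (ν := ν) (f := f) (u := u)
      (p := p) := by
  intro S h hS
  have hu : FunctionSpaces.Torus.IsSmoothSpaceTimeOn S u := h.smooth_velocity
  have hIoo_S : Ioo 0 T ⊆ S := Ioo_subset_Icc_self.trans hS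
  refine ⟨?_, ?_, ?_, ?_⟩
  -- (1) measurability on `(0,T) × ℝ^d`: `stLift u` is continuous there
  · exact (hu.continuousOn.mono (prod_mono hIoo_S subset_rfl)).aestronglyMeasurable
      (measurableSet_Ioo.prod MeasurableSet.univ)
  -- (2) square integrability: `u` is bounded on `[0,T] × T^d` (compactness)
  · obtain ⟨C, hC⟩ := (isCompact_Icc.prod (FunctionSpaces.Torus.isCompact_toLp_image_pi_Icc (d := d)))
      |>.exists_bound_of_continuousOn (f := FunctionSpaces.Torus.stLift u)
        (hu.continuousOn.mono (prod_mono hS (subset_univ _)))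
    have hb : ∀ t ∈ Ioo 0 T, ∀ x, ‖u t x‖ₑ ^ 2 ≤ ENNReal.ofReal C ^ 2 := by
      intro t ht x
      have h1 := hC (t, FunctionSpaces.Torus.repr x) ⟨Ioo_subset_Icc_self ht, FunctionSpaces.Torus.repr_mem_toLp_image_pi_Icc x⟩
      rw [FunctionSpaces.Torus.stLift_apply, FunctionSpaces.Torus.proj_repr] at h1
      gcongr
      rw [← ofReal_norm]
      exact ENNReal.ofReal_le_ofReal h1
    calc ∫⁻ t in Ioo 0 T, ∫⁻ x, ‖u t x‖ₑ ^ 2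
        ≤ ∫⁻ _ in Ioo 0 T, ENNReal.ofReal C ^ 2 :=
          setLIntegral_mono' measurableSet_Ioo fun t ht =>
            calc ∫⁻ x, ‖u t x‖ₑ ^ 2 ≤ ∫⁻ _, ENNReal.ofReal C ^ 2 := lintegral_mono (hb t ht)
              _ = ENNReal.ofReal C ^ 2 := by rw [lintegral_const, measure_univ, mul_one]
      _ = ENNReal.ofReal C ^ 2 * volume (Ioo 0 T) := setLIntegral_const _ _
      _ < ⊤ := ENNReal.mul_lt_top (ENNReal.pow_lt_top ENNReal.ofReal_lt_top)
          (by rw [Real.volume_Ioo]; exact ENNReal.ofReal_lt_top)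
  -- (3) `u(t)` is weakly divergence free for every `t ∈ (0,T)`
  · refine (ae_restrict_iff' measurableSet_Ioo).2 (ae_of_all _ fun t ht => ?_)
    exact (h.divFree t (hIoo_S ht)).isWeaklyDivFree_holds (hu.isSmooth_slice (hIoo_S ht))
  -- (4) the weak identity with datum
  · intro ψ hψ hψdiv
    obtain ⟨hψs, T', hT'T, hT'⟩ := id hψ
    rcases le_or_gt T 0 with hT | hT
    · rw [Ioo_eq_empty (not_lt.2 hT), Measure.restrict_empty, integral_zero_measure,
        hT' 0 (hT'T.le.trans hT)]
      simp
    -- the time interval `I = [0, T] ⊆ S` and the pairing `E(t) = ∫ ⟪u(t), ψ(t)⟫`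
    set I : Set ℝ := Icc 0 T with hI_def
    have hIS : I ⊆ S := hS
    have hU : UniqueDiffOn ℝ I := uniqueDiffOn_Icc hT
    have huI : FunctionSpaces.Torus.IsSmoothSpaceTimeOn I u := ContDiffOn.mono hu (prod_mono hIS subset_rfl)
    have hψI : FunctionSpaces.Torus.IsSmoothSpaceTimeOn I ψ := hψs.contDiffOn
    have hg : FunctionSpaces.Torus.IsSmoothSpaceTimeOn I (fun t x => ⟪u t x, ψ t x⟫_ℝ) := by
      change ContDiffOn ℝ ∞ (fun z => ⟪FunctionSpaces.Torus.stLift u z, FunctionSpaces.Torus.stLift ψ z⟫_ℝ) (I ×ˢ univ)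
      exact ContDiffOn.inner ℝ huI hψI
    set E : ℝ → ℝ := fun t => ∫ x, ⟪u t x, ψ t x⟫_ℝ with hE_def
    set E' : ℝ → ℝ := fun t => ∫ x, FunctionSpaces.Torus.timeDerivWithin I (fun t x => ⟪u t x, ψ t x⟫_ℝ) t x
      with hE'_def
    have hE : ∀ t ∈ I, HasDerivWithinAt E (E' t) I t := fun t ht =>
      hg.hasDerivWithinAt_integral (convex_Icc 0 T) ht
    have hE'cont : ContinuousOn E' I := hg.continuousOn_integral_timeDerivWithin hU
    -- `∫₀ᵀ E' = E(T) - E(0) = -∫ ⟪u 0, ψ 0⟫`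
    have hET : E T = 0 := by
      simp only [hE_def, hT' T hT'T.le, Pi.zero_apply, inner_zero_right, integral_zero]
    have hFTC : ∫ t in Ioo 0 T, E' t = E T - E 0 := by
      rw [← integral_Ioc_eq_integral_Ioo, ← intervalIntegral.integral_of_le hT.le,
        intervalIntegral.integral_eq_sub_of_hasDerivAt_of_le hT.le
          (fun t ht => (hE t ht).continuousWithinAt)
          (fun t ht => (hE t (Ioo_subset_Icc_self ht)).hasDerivAt (Icc_mem_nhds ht.1 ht.2))
          ((hE'cont.mono (uIcc_of_le hT.le).subset).intervalIntegrable)]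
    -- it suffices to identify the integrand with `E'` on `(0, T)`
    suffices hkey : ∫ t in Ioo 0 T, ∫ x, (⟪u t x, FunctionSpaces.Torus.timeDeriv ψ t x⟫_ℝ +
        ⟪u t x, FunctionSpaces.Torus.convect (u t) (ψ t) x⟫_ℝ + ν * ⟪u t x, FunctionSpaces.Torus.laplacian (ψ t) x⟫_ℝ + ⟪f t x, ψ t x⟫_ℝ) =
        ∫ t in Ioo 0 T, E' t by
      rw [hkey, hFTC, hET, zero_sub, hE_def, neg_add_cancel]
    refine setIntegral_congr_fun measurableSet_Ioo fun t ht => ?_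
    have htS : t ∈ S := hIoo_S ht
    have htI : t ∈ I := Ioo_subset_Icc_self ht
    have hut : FunctionSpaces.Torus.IsSmooth (u t) := hu.isSmooth_slice htS
    have hpt : FunctionSpaces.Torus.IsSmooth (p t) := h.smooth_pressure.isSmooth_slice htS
    have hψt : FunctionSpaces.Torus.IsSmooth (ψ t) := hψI.isSmooth_slice htI
    have hψ't : FunctionSpaces.Torus.IsSmooth (FunctionSpaces.Torus.timeDeriv ψ t) := hψ.timeDeriv.isSmooth_slice t
    have hAI : FunctionSpaces.Torus.IsSmooth (FunctionSpaces.Torus.timeDerivWithin I u t) := huI.isSmooth_timeDerivWithin hU htI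
    have hI_nhds : I ∈ 𝓝 t := Icc_mem_nhds ht.1 ht.2
    have hS_nhds : S ∈ 𝓝 t := mem_of_superset hI_nhds hIS
    -- the one-sided time derivatives within `I` and within `S` agree at interior times
    have hAeq : ∀ x, FunctionSpaces.Torus.timeDerivWithin I u t x = FunctionSpaces.Torus.timeDerivWithin S u t x := fun x => by
      rw [FunctionSpaces.Torus.timeDerivWithin, FunctionSpaces.Torus.timeDerivWithin, derivWithin_of_mem_nhds hI_nhds,
        derivWithin_of_mem_nhds hS_nhds]
    -- the momentum equation, solved for `∂ₜu`
    have h3 : ∀ x, FunctionSpaces.Torus.timeDerivWithin S u t x = ν • FunctionSpaces.Torus.laplacian (u t) x - FunctionSpaces.Torus.gradient (p t) x -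
        FunctionSpaces.Torus.convect (u t) (u t) x + f t x := fun x => by
      have hm := h.momentum t htS x
      rw [← sub_eq_zero] at hm ⊢
      rw [← hm]
      abel
    -- hence the force slice `f t` is smooth
    have hft : FunctionSpaces.Torus.IsSmooth (f t) := by
      have hfeq : f t = fun x => FunctionSpaces.Torus.timeDerivWithin I u t x + FunctionSpaces.Torus.convect (u t) (u t) x -
          ν • FunctionSpaces.Torus.laplacian (u t) x + FunctionSpaces.Torus.gradient (p t) x := by
        funext x
        rw [hAeq x, h3 x]
        abel
      rw [hfeq]
      exact ((hAI.add (hut.convect hut)).sub (hut.laplacian.smul ν)).add hpt.gradient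
    -- pointwise: `∂ₜ⟪u, ψ⟫ = ⟪u, ∂ₜψ⟫ + ⟪νΔu - ∇p - (u·∇)u + f, ψ⟫` on `(0,T)`
    have hslice : ∀ x, FunctionSpaces.Torus.timeDerivWithin I (fun t x => ⟪u t x, ψ t x⟫_ℝ) t x =
        ⟪u t x, FunctionSpaces.Torus.timeDeriv ψ t x⟫_ℝ +
          ⟪ν • FunctionSpaces.Torus.laplacian (u t) x - FunctionSpaces.Torus.gradient (p t) x - FunctionSpaces.Torus.convect (u t) (u t) x + f t x,
            ψ t x⟫_ℝ := by
      intro x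
      have h1 : HasDerivWithinAt (fun τ => u τ x) (FunctionSpaces.Torus.timeDerivWithin S u t x) I t := by
        have h' := huI.hasDerivWithinAt_slice htI x
        rwa [hAeq x] at h'
      have h2 : HasDerivWithinAt (fun τ => ψ τ x) (FunctionSpaces.Torus.timeDeriv ψ t x) I t := by
        obtain ⟨y, rfl⟩ := FunctionSpaces.Torus.proj_surjective x
        have hd : Differentiable ℝ (fun τ : ℝ => FunctionSpaces.Torus.stLift ψ (τ, y)) :=
          (hψs.differentiable (by simp)).comp (differentiable_id.prodMk (differentiable_const y))
        exact (hd t).hasDerivAt.hasDerivWithinAt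
      have h12 := (h1.inner ℝ h2).derivWithin (hU t htI)
      rw [FunctionSpaces.Torus.timeDerivWithin, h12, h3]
    -- integrate over the torus and integrate by parts
    have i1 : Integrable (fun x => ⟪u t x, FunctionSpaces.Torus.timeDeriv ψ t x⟫_ℝ) volume := (hut.inner hψ't).integrable
    have i2 : Integrable (fun x => ⟪u t x, FunctionSpaces.Torus.convect (u t) (ψ t) x⟫_ℝ) volume :=
      (hut.inner (hut.convect hψt)).integrable
    have i12 : Integrable (fun x => ⟪u t x, FunctionSpaces.Torus.timeDeriv ψ t x⟫_ℝ +
        ⟪u t x, FunctionSpaces.Torus.convect (u t) (ψ t) x⟫_ℝ) volume := i1.add i2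
    have i3 : Integrable (fun x => ν * ⟪u t x, FunctionSpaces.Torus.laplacian (ψ t) x⟫_ℝ) volume :=
      ((hut.inner hψt.laplacian).integrable).const_mul ν
    have i123 : Integrable (fun x => ⟪u t x, FunctionSpaces.Torus.timeDeriv ψ t x⟫_ℝ +
        ⟪u t x, FunctionSpaces.Torus.convect (u t) (ψ t) x⟫_ℝ + ν * ⟪u t x, FunctionSpaces.Torus.laplacian (ψ t) x⟫_ℝ) volume := i12.add i3
    have iF : Integrable (fun x => ⟪f t x, ψ t x⟫_ℝ) volume := (hft.inner hψt).integrable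
    have iL : Integrable (fun x => ⟪ν • FunctionSpaces.Torus.laplacian (u t) x, ψ t x⟫_ℝ) volume :=
      ((hut.laplacian.smul ν).inner hψt).integrable
    have iG : Integrable (fun x => ⟪FunctionSpaces.Torus.gradient (p t) x, ψ t x⟫_ℝ) volume :=
      (hpt.gradient.inner hψt).integrable
    have iC : Integrable (fun x => ⟪FunctionSpaces.Torus.convect (u t) (u t) x, ψ t x⟫_ℝ) volume :=
      ((hut.convect hut).inner hψt).integrable
    have iLG : Integrable (fun x => ⟪ν • FunctionSpaces.Torus.laplacian (u t) x, ψ t x⟫_ℝ -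
        ⟪FunctionSpaces.Torus.gradient (p t) x, ψ t x⟫_ℝ) volume := iL.sub iG
    have iLGC : Integrable (fun x => ⟪ν • FunctionSpaces.Torus.laplacian (u t) x, ψ t x⟫_ℝ -
        ⟪FunctionSpaces.Torus.gradient (p t) x, ψ t x⟫_ℝ - ⟪FunctionSpaces.Torus.convect (u t) (u t) x, ψ t x⟫_ℝ) volume := iLG.sub iC
    have iLGCF : Integrable (fun x => ⟪ν • FunctionSpaces.Torus.laplacian (u t) x, ψ t x⟫_ℝ -
        ⟪FunctionSpaces.Torus.gradient (p t) x, ψ t x⟫_ℝ - ⟪FunctionSpaces.Torus.convect (u t) (u t) x, ψ t x⟫_ℝ + ⟪f t x, ψ t x⟫_ℝ)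
        volume := iLGC.add iF
    have hlap : ∫ x, ⟪ν • FunctionSpaces.Torus.laplacian (u t) x, ψ t x⟫_ℝ = ∫ x, ν * ⟪u t x, FunctionSpaces.Torus.laplacian (ψ t) x⟫_ℝ := by
      simp_rw [real_inner_smul_left, integral_const_mul]
      rw [FunctionSpaces.Torus.integral_inner_laplacian_comm hut hψt]
    have hgrad : ∫ x, ⟪FunctionSpaces.Torus.gradient (p t) x, ψ t x⟫_ℝ = 0 :=
      FunctionSpaces.Torus.integral_inner_gradient_eq_zero_of_isDivFree hψt hpt (hψdiv t)
    have hconv : ∫ x, ⟪FunctionSpaces.Torus.convect (u t) (u t) x, ψ t x⟫_ℝ = -∫ x, ⟪u t x, FunctionSpaces.Torus.convect (u t) (ψ t) x⟫_ℝ :=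
      FunctionSpaces.Torus.integral_inner_convect_eq_neg hut (h.divFree t htS) hut hψt
    rw [integral_add i123 iF, integral_add i12 i3, integral_add i1 i2]
    simp only [hE'_def]
    simp_rw [hslice, inner_add_left, inner_sub_left]
    rw [integral_add i1 iLGCF, integral_add iLGC iF, integral_sub iLG iC, integral_sub iL iG, hlap,
      hgrad, hconv]
    ring

end Torus

/-! ### Whole space: restriction in time and in the space–time region -/

section FluidOpen

open Function TopologicalSpace
open scoped RealInnerProductSpace Laplacian

section Fluid

section SpaceTimeVanish

variable {X : Type*} [NormedAddCommGroup X] [NormedSpace ℝ X]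
variable {F : Type*} [NormedAddCommGroup F] [NormedSpace ℝ F]

/-- A space–time test field on `Q` vanishes near every point outside `Q`: if `(t, x) ∉ Q` then
`ψ(·, x)` vanishes on a neighbourhood of `t`, so `∂ₜψ(t, x) = 0` (the topological support of
the uncurried field is a closed subset of `Q`). [folklore] -/
theorem IsSpaceTimeTestOn.deriv_eq_zero {Q : Opens (ℝ × X)} {ψ : ℝ → X → F}
    (hψ : IsSpaceTimeTestOn Q ψ) {t : ℝ} {x : X} (h : (t, x) ∉ (Q : Set (ℝ × X))) :
    deriv (fun s => ψ s x) t = 0 := by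
  have hnot : (t, x) ∉ tsupport (uncurry ψ) := fun hz => h (hψ.tsupport_subset hz)
  have h0 : uncurry ψ =ᶠ[𝓝 (t, x)] 0 := notMem_tsupport_iff_eventuallyEq.1 hnot
  have hc : Continuous fun s : ℝ => (s, x) := continuous_id.prodMk continuous_const
  have h1 : (fun s => ψ s x) =ᶠ[𝓝 t] fun _ => (0 : F) := (hc.tendsto t).eventually h0
  rw [h1.deriv_eq, deriv_const]

/-- Outside `Q`, the time derivative of a space–time test field on `Q` vanishes:
`timeDeriv ψ t x = 0` for `(t, x) ∉ Q`. [folklore] -/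
theorem IsSpaceTimeTestOn.timeDeriv_eq_zero {Q : Opens (ℝ × X)} {ψ : ℝ → X → F}
    (hψ : IsSpaceTimeTestOn Q ψ) {t : ℝ} {x : X} (h : (t, x) ∉ (Q : Set (ℝ × X))) :
    timeDeriv ψ t x = 0 :=
  hψ.deriv_eq_zero h

/-- Outside `Q`, the slices of a space–time test field on `Q` have vanishing spatial derivative:
`D(ψ t)(x) = 0` for `(t, x) ∉ Q` (the slice `ψ t` vanishes near `x`). [folklore] -/
theorem IsSpaceTimeTestOn.fderiv_slice_eq_zero {Q : Opens (ℝ × X)} {ψ : ℝ → X → F}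
    (hψ : IsSpaceTimeTestOn Q ψ) {t : ℝ} {x : X} (h : (t, x) ∉ (Q : Set (ℝ × X))) :
    fderiv ℝ (ψ t) x = 0 := by
  have hnot : (t, x) ∉ tsupport (uncurry ψ) := fun hz => h (hψ.tsupport_subset hz)
  have h0 : uncurry ψ =ᶠ[𝓝 (t, x)] 0 := notMem_tsupport_iff_eventuallyEq.1 hnot
  have hc : Continuous fun y : X => (t, y) := continuous_const.prodMk continuous_id
  have h1 : ψ t =ᶠ[𝓝 x] fun _ => (0 : F) := (hc.tendsto x).eventually h0
  rw [h1.fderiv_eq, fderiv_fun_const, Pi.zero_apply]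

/-- A space–time test field on a slab `I × X` has identically vanishing time slices `ψ t = 0`
for `t ∉ I`. [folklore] -/
theorem IsSpaceTimeTestOn.slice_eq_zero {I : Set ℝ} {hI : IsOpen I} {ψ : ℝ → X → F}
    (hψ : IsSpaceTimeTestOn (slab X I hI) ψ) {t : ℝ} (ht : t ∉ I) : ψ t = 0 :=
  funext fun _ => hψ.apply_eq_zero fun hz => ht (mem_slab.1 (SetLike.mem_coe.1 hz))

end SpaceTimeVanish

section SpaceTimeVanishLaplacian

variable {E : Type*} [NormedAddCommGroup E] [InnerProductSpace ℝ E] [FiniteDimensional ℝ E]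
variable {F : Type*} [NormedAddCommGroup F] [NormedSpace ℝ F]

/-- Outside `Q`, the Laplacian of the slices of a space–time test field on `Q` vanishes
(`InnerProductSpace.laplacian_congr_nhds` with the zero field). [folklore] -/
theorem IsSpaceTimeTestOn.laplacian_slice_eq_zero {Q : Opens (ℝ × E)} {ψ : ℝ → E → F}
    (hψ : IsSpaceTimeTestOn Q ψ) {t : ℝ} {x : E} (h : (t, x) ∉ (Q : Set (ℝ × E))) :
    Δ (ψ t) x = 0 := by
  have hnot : (t, x) ∉ tsupport (uncurry ψ) := fun hz => h (hψ.tsupport_subset hz)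
  have h0 : uncurry ψ =ᶠ[𝓝 (t, x)] 0 := notMem_tsupport_iff_eventuallyEq.1 hnot
  have hc : Continuous fun y : E => (t, y) := continuous_const.prodMk continuous_id
  have h1 : ψ t =ᶠ[𝓝 x] fun _ => (0 : F) := (hc.tendsto x).eventually h0
  rw [(InnerProductSpace.laplacian_congr_nhds h1).self_of_nhds, InnerProductSpace.laplacian_const,
    Pi.zero_apply]

end SpaceTimeVanishLaplacian

section WeakMono

variable {E : Type*} [NormedAddCommGroup E] [InnerProductSpace ℝ E] [FiniteDimensional ℝ E]
  [MeasurableSpace E] [BorelSpace E]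
variable {T T' ν : ℝ} {f u : ℝ → E → E} {u₀ : E → E} {p : ℝ → E → ℝ}

/-- **Discharge of `Fluid.IsWeakNSSolutionOn.mono`** (`WeakSolution`; Leray 1934, §III):
a weak solution on `[0, T)` is a weak solution on `[0, T')` for every `T' ≤ T`. Measurability,
local square integrability and the a.e. divergence constraint restrict along
`(0, T') × E ⊆ (0, T) × E`; a divergence-free test field `ψ` supported in `(-∞, T') × E` is one
supported in `(-∞, T) × E`, and `ψ`, `∂ₜψ`, `Dψ`, `Δψ` vanish at every `(t, x)` with `t ≥ T'`,
so the weak integrand vanishes on `[T', T)` and `∫_{(0,T)} = ∫_{(0,T')}`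
(`setIntegral_eq_of_subset_of_forall_sdiff_eq_zero`). [cite: Leray1934, §III] -/
theorem IsWeakNSSolutionOn.mono_holds :
    IsWeakNSSolutionOn.mono (T := T) (T' := T') (ν := ν) (f := f) (u₀ := u₀) (u := u) := by
  intro h hT
  obtain ⟨hmeas, hL2, hdiv, hweak⟩ := h
  have hsub : Ioo (0 : ℝ) T' ⊆ Ioo 0 T := Ioo_subset_Ioo_right hT
  have hsub' : Ioo (0 : ℝ) T' ×ˢ (univ : Set E) ⊆ Ioo 0 T ×ˢ univ := prod_mono hsub Subset.rfl
  refine ⟨hmeas.mono_measure (Measure.restrict_mono hsub' le_rfl), fun K hK =>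
    lt_of_le_of_lt (lintegral_mono_set (prod_mono hsub Subset.rfl)) (hL2 K hK),
    ae_mono (Measure.restrict_mono hsub le_rfl) hdiv, fun ψ hψ hψdiv => ?_⟩
  have hψT : IsSpaceTimeTestOn (slab E (Iio T) isOpen_Iio) ψ :=
    hψ.mono (slab_mono (Iio_subset_Iio hT))
  have key := hweak ψ hψT hψdiv
  rw [setIntegral_eq_of_subset_of_forall_sdiff_eq_zero measurableSet_Ioo hsub] at key
  · exact key
  · intro t ht
    have hz : ∀ x : E, (t, x) ∉ ((slab E (Iio T') isOpen_Iio : Opens (ℝ × E)) : Set (ℝ × E)) :=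
      fun x hx => ht.2 ⟨ht.1.1, mem_slab.1 (SetLike.mem_coe.1 hx)⟩
    have h1 : ∀ x, deriv (fun s => ψ s x) t = 0 := fun x => hψ.deriv_eq_zero (hz x)
    have h2 : ∀ x, fderiv ℝ (ψ t) x = 0 := fun x => hψ.fderiv_slice_eq_zero (hz x)
    have h3 : ∀ x, Δ (ψ t) x = 0 := fun x => hψ.laplacian_slice_eq_zero (hz x)
    have h4 : ∀ x, ψ t x = 0 := fun x => hψ.apply_eq_zero (hz x)
    simp [h1, convect, h2, h3, h4]

/-- The restriction of a weak solution to a shorter time interval, as a usable lemma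
(`IsWeakNSSolutionOn.mono_holds`; Leray 1934, §III). [cite: Leray1934, §III] -/
theorem IsWeakNSSolutionOn.of_le (h : IsWeakNSSolutionOn T ν f u₀ u) (hT : T' ≤ T) :
    IsWeakNSSolutionOn T' ν f u₀ u :=
  IsWeakNSSolutionOn.mono_holds h hT

/-- **Discharge of `Fluid.IsDistributionalNSSolutionOn.mono`** (`WeakSolution`;
Caffarelli–Kohn–Nirenberg 1982, §2): a distributional (pressure-explicit) solution on an open
space–time region `Q` is one on every open `Q' ≤ Q`. Local integrability restricts
(`LocallyIntegrableOn.mono_set`); a test field on `Q'` is a test field on `Q`, and since it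
vanishes together with `∂ₜ`, `D`, `Δ`, `div` at the points of `Q ∖ Q'`, the integrals of the
weak integrands over `Q` and over `Q'` agree
(`setIntegral_eq_of_subset_of_forall_sdiff_eq_zero`). [cite: CaffarelliKohnNirenberg1982, §2] -/
theorem IsDistributionalNSSolutionOn.mono_holds :
    IsDistributionalNSSolutionOn.mono (ν := ν) (f := f) (u := u) (p := p) := by
  intro Q Q' h hQ
  obtain ⟨hu, hu2, hp, hdiv, hmom⟩ := h
  have hQs : ((Q' : Opens (ℝ × E)) : Set (ℝ × E)) ⊆ (Q : Set (ℝ × E)) := hQ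
  refine ⟨hu.mono_set hQs, hu2.mono_set hQs, hp.mono_set hQs, fun θ hθ => ?_, fun ψ hψ => ?_⟩
  · have key := hdiv θ (hθ.mono hQ)
    rw [setIntegral_eq_of_subset_of_forall_sdiff_eq_zero Q.isOpen.measurableSet hQs] at key
    · exact key
    · rintro ⟨t, x⟩ hz
      have hg : gradient (θ t) x = 0 := by
        rw [gradient, hθ.fderiv_slice_eq_zero hz.2, map_zero]
      simp [hg]
  · have key := hmom ψ (hψ.mono hQ)
    rw [setIntegral_eq_of_subset_of_forall_sdiff_eq_zero Q.isOpen.measurableSet hQs] at key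
    · exact key
    · rintro ⟨t, x⟩ hz
      have h1 : deriv (fun s => ψ s x) t = 0 := hψ.deriv_eq_zero hz.2
      have h2 : fderiv ℝ (ψ t) x = 0 := hψ.fderiv_slice_eq_zero hz.2
      have h3 : Δ (ψ t) x = 0 := hψ.laplacian_slice_eq_zero hz.2
      have h4 : ψ t x = 0 := hψ.apply_eq_zero hz.2
      have h5 : VectorCalculus.divergence (ψ t) x = 0 := by simp [VectorCalculus.divergence, h2]
      simp [h1, convect, h2, h3, h4, h5]

/-- The restriction of a distributional solution to a smaller open region, as a usable lemma
(`IsDistributionalNSSolutionOn.mono_holds`; Caffarelli–Kohn–Nirenberg 1982, §2). [cite: CaffarelliKohnNirenberg1982, §2] -/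
theorem IsDistributionalNSSolutionOn.of_le {Q Q' : Opens (ℝ × E)}
    (h : IsDistributionalNSSolutionOn Q ν f u p) (hQ : Q' ≤ Q) :
    IsDistributionalNSSolutionOn Q' ν f u p :=
  IsDistributionalNSSolutionOn.mono_holds h hQ

end WeakMono

end Fluid

end FluidOpen

end Literature.Analysis.FluidPDE
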